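import Mathlib
import Summits.ResolutionOfSingularities.ResolutionOfSingularities.Theorems.HomologicalConductorPersistenceCusp34Kernel

/-!
# K-C3 §H2L piece K2b-ii (W4.4b): the range of the normalisation of `z³ + t⁴` contains everything of order `≥ 6`

[OURS · L1 w44b] For the normalisation `ν : k⟦z,t⟧ → k⟦s⟧`, `z ↦ -s⁴`, `t ↦ s³` (brick 1, `Cusp34.normHom`):
every power series splits as `d = a₀(s³) + s·a₁(s³) + s²·a₂(s³)` (`expand_three_decomposition`), the `aᵢ(s³)` are values of `ν`
(`psiHom_C`, brick 4), and `s⁶ = ν(t²)`, `s⁷ = ν(-zt)`, `s⁸ = ν(z²)`; hence **`s⁶·d ∈ range ν` for every `d`**, i.e. every series of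
order `≥ 6` (the conductor exponent of the semigroup `⟨3,4⟩`) is a value of `ν` — CHAIN K2b-ii «range ⊇ {order ≥ 6}».
NOT a statement of the manuscript under review.
-/

set_option linter.dupNamespace false

noncomputable section

open PowerSeries

namespace Summit.ResolutionOfSingularities.ResolutionOfSingularities.Theorems.HomologicalConductor.Cusp34

universe u

section Decomposition

variable {R : Type u} [CommRing R]

/-- **Residue decomposition mod 3**: `d = a₀(s³) + s·a₁(s³) + s²·a₂(s³)`. [OURS] -/
theorem expand_three_decomposition (d : PowerSeries R) :
    ∃ a₀ a₁ a₂ : PowerSeries R,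
      d = expand 3 (by norm_num) a₀ + X * expand 3 (by norm_num) a₁ + X ^ 2 * expand 3 (by norm_num) a₂ := by
  refine ⟨PowerSeries.mk fun m => coeff (3 * m) d, PowerSeries.mk fun m => coeff (3 * m + 1) d,
    PowerSeries.mk fun m => coeff (3 * m + 2) d, ?_⟩
  ext n
  have h0 := coeff_X_pow_mul_expand_three (PowerSeries.mk fun m => coeff (3 * m) d) 0 n
  have h1 := coeff_X_pow_mul_expand_three (PowerSeries.mk fun m => coeff (3 * m + 1) d) 1 n
  have h2 := coeff_X_pow_mul_expand_three (PowerSeries.mk fun m => coeff (3 * m + 2) d) 2 n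
  rw [pow_zero, one_mul] at h0
  rw [pow_one] at h1
  rw [map_add, map_add, h0, h1, h2]
  obtain ⟨m, rfl | rfl | rfl⟩ : ∃ m, n = 3 * m ∨ n = 3 * m + 1 ∨ n = 3 * m + 2 := ⟨n / 3, by omega⟩
  · rw [if_pos ⟨by omega, by omega⟩, if_neg (by omega), if_neg (by omega), coeff_mk, add_zero, add_zero]
    have : (3 * m - 0) / 3 = m := by omega
    rw [this]
  · rw [if_neg (by omega), if_pos ⟨by omega, by omega⟩, if_neg (by omega), coeff_mk, zero_add, add_zero]
    have : (3 * m + 1 - 1) / 3 = m := by omega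
    rw [this]
  · rw [if_neg (by omega), if_neg (by omega), if_pos ⟨by omega, by omega⟩, coeff_mk, zero_add, zero_add]
    have : (3 * m + 2 - 2) / 3 = m := by omega
    rw [this]

end Decomposition

variable (k : Type u) [Field k]

/-- `a(s³) = ν(E⁻¹(C a))` is a value of `ν`. [OURS] -/
theorem expand_mem_range_normHom (a : PowerSeries k) :
    expand 3 (by norm_num) a ∈ Set.range (normHom k) :=
  ⟨(nestE k).symm (C a), by rw [← psiHom_apply, psiHom_C]⟩

/-- **`s⁶·d ∈ range ν`** for every `d`. [OURS] -/
theorem X_pow_six_mul_mem_range_normHom (d : PowerSeries k) :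
    (X : PowerSeries k) ^ 6 * d ∈ Set.range (normHom k) := by
  obtain ⟨a₀, a₁, a₂, hd⟩ := expand_three_decomposition d
  obtain ⟨A₀, hA₀⟩ := expand_mem_range_normHom k a₀
  obtain ⟨A₁, hA₁⟩ := expand_mem_range_normHom k a₁
  obtain ⟨A₂, hA₂⟩ := expand_mem_range_normHom k a₂
  refine ⟨MvPowerSeries.X 1 ^ 2 * A₀ - MvPowerSeries.X 1 * MvPowerSeries.X 0 * A₁ + MvPowerSeries.X 0 ^ 2 * A₂, ?_⟩
  rw [map_add, map_sub, map_mul, map_mul, map_mul, map_mul, map_pow, map_pow, normHom_X_zero, normHom_X_one, hA₀, hA₁,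
    hA₂, hd]
  ring

/-- `sⁿ·d ∈ range ν` for every `n ≥ 6` and every `d` (in particular `ν(z²)·d, ν(zt)·d, ν(t²)·d`). [OURS] -/
theorem X_pow_mul_mem_range_normHom (n : ℕ) (hn : 6 ≤ n) (d : PowerSeries k) :
    (X : PowerSeries k) ^ n * d ∈ Set.range (normHom k) := by
  obtain ⟨j, rfl⟩ := Nat.exists_eq_add_of_le hn
  rw [pow_add, mul_assoc]
  exact X_pow_six_mul_mem_range_normHom k _

/-- **Range ⊇ {order ≥ 6}**: every power series of order at least `6` is a value of `ν`. [OURS] -/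
theorem mem_range_normHom_of_le_order (d : PowerSeries k) (hd : (6 : ℕ∞) ≤ d.order) :
    d ∈ Set.range (normHom k) := by
  obtain ⟨d', rfl⟩ : (X : PowerSeries k) ^ 6 ∣ d :=
    X_pow_dvd_iff.mpr fun m hm => coeff_of_lt_order m (lt_of_lt_of_le (by exact_mod_cast hm) hd)
  exact X_pow_six_mul_mem_range_normHom k d'

/-- `ν̄ ∘ mk = ν`. [OURS] -/
theorem normQuotHom_mk (F : MvPowerSeries (Fin 2) k) :
    normQuotHom k (Ideal.Quotient.mk _ F) = normHom k F :=
  Ideal.Quotient.lift_mk _ _ _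

/-- `range ν̄ = range ν`. [OURS] -/
theorem range_normQuotHom : Set.range (normQuotHom k) = Set.range (normHom k) := by
  ext d
  constructor
  · rintro ⟨q, rfl⟩
    obtain ⟨F, rfl⟩ := Ideal.Quotient.mk_surjective q
    exact ⟨F, (normQuotHom_mk k F).symm⟩
  · rintro ⟨F, rfl⟩
    exact ⟨Ideal.Quotient.mk _ F, normQuotHom_mk k F⟩

/-- Quotient form: every series of order `≥ 6` is a value of the injective map `ν̄ : k⟦z,t⟧/(z³+t⁴) ↪ k⟦s⟧`. [OURS] -/
theorem mem_range_normQuotHom_of_le_order (d : PowerSeries k) (hd : (6 : ℕ∞) ≤ d.order) :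
    d ∈ Set.range (normQuotHom k) := by
  rw [range_normQuotHom]
  exact mem_range_normHom_of_le_order k d hd

end Summit.ResolutionOfSingularities.ResolutionOfSingularities.Theorems.HomologicalConductor.Cusp34

end
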